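import Mathlib
import HarnessLib
import Summits.CriticalPhenomena.CardyFormulaZ2.Theorems.CardyMagicRigidityMagicFormulaTStubEntire

/-!
# Line `Sketch` (v8) for crux `MagicFormulaT`: the Taylor coefficients of orders `2` and `3` of the
# twisted product at zero coupling

Crux `Summit.CriticalPhenomena.CardyFormulaZ2.Theses.CardyMagicRigidity.MagicFormulaT`
(stmt-CriticalPhenomena-4836), line `Sketch`, skeleton v8, wave-2 sub-goals `cf_iteratedDeriv_two_finprod`
and `cf_iteratedDeriv_three_finprod`.  For an admissible density `f` (`f = 0` off `B̄(0, R)`, `∫ f = 0`) and a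
loop family `L` of which finitely many members meet `B̄(0, R)`, the pathwise twisted product
`P(t) = ∏ᶠ_{u ∈ L} 2cos(t θ_u + π/3)` (`θ_u = u.nestingPhase f`) satisfies
`P''(0) = 3A₁² − 4A₂` and `P'''(0) = √3(−3A₁³ + 12A₁A₂ − 8A₃)` with the power sums `A_m = Σᶠ_{u∈L} θ_u^m`.

Proof.  Only loops meeting the ball have `θ_u ≠ 0` (`sw_meets_of_nestingPhase_ne_zero`), so `P` is a finite
product over a `t`-independent finite family (`stubEntire_finprod_eq_prod`) and the `A_m` are finite sums.
For a finite product `P_S(t) = ∏_{i∈S} 2cos(t c_i + π/3)` the quadruple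
`(P_S, P_S', P_S'', P_S''')(0) = (1, −√3 A₁, 3A₁² − 4A₂, √3(−3A₁³ + 12A₁A₂ − 8A₃))` is proved by induction on
`S` with the two-factor Leibniz rule `iteratedDeriv_mul`, the single-factor values
`(2cos(tc + π/3))^{(n)}(0) = 2cⁿcos^{(n)}(π/3) = 1, −√3c, −c², √3c³` (`n = 0, 1, 2, 3`;
`iteratedDeriv_comp_const_mul`, `iteratedDeriv_comp_add_const`, `cos(π/3) = 1/2`, `sin(π/3) = √3/2`) and
`ring` identities for the power sums of `insert a S`.  No named fact is used; no definition is introduced.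
-/

noncomputable section

namespace Summit.CriticalPhenomena.CardyFormulaZ2.Cruxes.MagicFormulaT.LineSketch

open MeasureTheory Filter Set Metric
open scoped Real Topology BigOperators ENNReal
open Literature.Probability.RandomPlanarGeometry Literature.Probability.Percolation
  Literature.Probability.LatticeModels

/-! ## The single factor `2cos(t c + π/3)` -/

/-- `∂ⁿ_t 2cos(t c + π/3) |_{t = 0} = 2 cⁿ cos⁽ⁿ⁾(π/3)` (chain rule for an affine reparametrisation). -/
theorem cff_iteratedDeriv_factor (c : ℂ) (n : ℕ) :
    iteratedDeriv n (fun t : ℂ ↦ 2 * Complex.cos (t * c + (Real.pi : ℂ) / 3)) 0 =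
      2 * c ^ n * iteratedDeriv n Complex.cos ((Real.pi : ℂ) / 3) := by
  have hg : ContDiff ℂ n (fun z : ℂ ↦ Complex.cos (z + (Real.pi : ℂ) / 3)) := by fun_prop
  have h1 : iteratedDeriv n (fun x : ℂ ↦ Complex.cos (c * x + (Real.pi : ℂ) / 3)) =
      fun x ↦ c ^ n * iteratedDeriv n (fun z : ℂ ↦ Complex.cos (z + (Real.pi : ℂ) / 3)) (c * x) :=
    iteratedDeriv_comp_const_mul hg c
  have h2 : (fun t : ℂ ↦ 2 * Complex.cos (t * c + (Real.pi : ℂ) / 3)) =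
      fun t ↦ 2 * Complex.cos (c * t + (Real.pi : ℂ) / 3) := by
    funext t
    rw [mul_comm t c]
  rw [h2, iteratedDeriv_const_mul_field, h1]
  simp only [iteratedDeriv_comp_add_const, mul_zero, zero_add, mul_assoc]

/-- The first four `t`-derivatives of `2cos(t c + π/3)` at `t = 0`: `1, −√3 c, −c², √3 c³`
(`cos(π/3) = 1/2`, `sin(π/3) = √3/2`). -/
theorem cff_iteratedDeriv_factor_values (c : ℂ) :
    iteratedDeriv 0 (fun t : ℂ ↦ 2 * Complex.cos (t * c + (Real.pi : ℂ) / 3)) 0 = 1 ∧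
    iteratedDeriv 1 (fun t : ℂ ↦ 2 * Complex.cos (t * c + (Real.pi : ℂ) / 3)) 0 =
      -((Real.sqrt 3 : ℝ) : ℂ) * c ∧
    iteratedDeriv 2 (fun t : ℂ ↦ 2 * Complex.cos (t * c + (Real.pi : ℂ) / 3)) 0 = -c ^ 2 ∧
    iteratedDeriv 3 (fun t : ℂ ↦ 2 * Complex.cos (t * c + (Real.pi : ℂ) / 3)) 0 =
      ((Real.sqrt 3 : ℝ) : ℂ) * c ^ 3 := by
  obtain ⟨hc, hs⟩ := stubEntire_cos_sin_pi_div_three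
  have h1 : iteratedDeriv 1 Complex.cos = -Complex.sin := by
    simpa using Complex.iteratedDeriv_add_one_cos 0
  have h2 : iteratedDeriv 2 Complex.cos = -Complex.cos := by
    simp
  have h3 : iteratedDeriv 3 Complex.cos = Complex.sin := by
    simpa using Complex.iteratedDeriv_odd_cos 1
  simp only [cff_iteratedDeriv_factor, iteratedDeriv_zero, h1, h2, h3, Pi.neg_apply, hc, hs]
  refine ⟨by ring, by ring, by ring, by ring⟩

/-! ## Finite products: the joint induction -/

/-- **Derivatives of orders `≤ 3` at zero coupling of a finite twisted product.**  For
`P_S(t) = ∏_{i ∈ S} 2cos(t c_i + π/3)` and the power sums `A_m = Σ_{i∈S} c_i^m`: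
`P_S(0) = 1`, `P_S'(0) = −√3 A₁`, `P_S''(0) = 3A₁² − 4A₂`, `P_S'''(0) = √3(−3A₁³ + 12A₁A₂ − 8A₃)`
(induction on `S`, Leibniz rule `iteratedDeriv_mul`, and the single-factor values). -/
theorem cff_iteratedDeriv_prod {ι : Type*} (c : ι → ℂ) (S : Finset ι) :
    iteratedDeriv 0 (fun t : ℂ ↦ ∏ i ∈ S, 2 * Complex.cos (t * c i + (Real.pi : ℂ) / 3)) 0 = 1 ∧
    iteratedDeriv 1 (fun t : ℂ ↦ ∏ i ∈ S, 2 * Complex.cos (t * c i + (Real.pi : ℂ) / 3)) 0 =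
      -((Real.sqrt 3 : ℝ) : ℂ) * ∑ i ∈ S, c i ∧
    iteratedDeriv 2 (fun t : ℂ ↦ ∏ i ∈ S, 2 * Complex.cos (t * c i + (Real.pi : ℂ) / 3)) 0 =
      3 * (∑ i ∈ S, c i) ^ 2 - 4 * ∑ i ∈ S, c i ^ 2 ∧
    iteratedDeriv 3 (fun t : ℂ ↦ ∏ i ∈ S, 2 * Complex.cos (t * c i + (Real.pi : ℂ) / 3)) 0 =
      ((Real.sqrt 3 : ℝ) : ℂ) * (-3 * (∑ i ∈ S, c i) ^ 3 + 12 * (∑ i ∈ S, c i) * (∑ i ∈ S, c i ^ 2) -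
        8 * ∑ i ∈ S, c i ^ 3) := by
  classical
  induction S using Finset.induction_on with
  | empty =>
    simp only [Finset.prod_empty, Finset.sum_empty, iteratedDeriv_const]
    norm_num
  | insert a S ha IH =>
    obtain ⟨IH0, IH1, IH2, IH3⟩ := IH
    obtain ⟨F0, F1, F2, F3⟩ := cff_iteratedDeriv_factor_values (c a)
    have hprod : (fun t : ℂ ↦ ∏ i ∈ insert a S, 2 * Complex.cos (t * c i + (Real.pi : ℂ) / 3)) =
        fun t ↦ 2 * Complex.cos (t * c a + (Real.pi : ℂ) / 3) *
          ∏ i ∈ S, 2 * Complex.cos (t * c i + (Real.pi : ℂ) / 3) :=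
      funext fun t ↦ Finset.prod_insert ha
    have hf : ∀ n : ℕ, ContDiffAt ℂ n (fun t : ℂ ↦ 2 * Complex.cos (t * c a + (Real.pi : ℂ) / 3)) 0 :=
      fun n ↦ by fun_prop
    have hg : ∀ n : ℕ,
        ContDiffAt ℂ n (fun t : ℂ ↦ ∏ i ∈ S, 2 * Complex.cos (t * c i + (Real.pi : ℂ) / 3)) 0 :=
      fun n ↦ by fun_prop
    have h3 : ((Real.sqrt 3 : ℝ) : ℂ) * ((Real.sqrt 3 : ℝ) : ℂ) = 3 := by
      rw [← Complex.ofReal_mul, Real.mul_self_sqrt zero_le_three]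
      norm_num
    rw [hprod, Finset.sum_insert ha, Finset.sum_insert ha, Finset.sum_insert ha]
    refine ⟨?_, ?_, ?_, ?_⟩
    · rw [iteratedDeriv_fun_mul (hf 0) (hg 0)]
      simp only [Finset.sum_range_succ, Finset.sum_range_zero, IH0, F0]
      norm_num
    · rw [iteratedDeriv_fun_mul (hf 1) (hg 1)]
      simp only [Finset.sum_range_succ, Finset.sum_range_zero, Nat.reduceSub, IH0, IH1, F0, F1]
      norm_num
      ring
    · rw [iteratedDeriv_fun_mul (hf 2) (hg 2)]
      simp only [Finset.sum_range_succ, Finset.sum_range_zero, Nat.reduceSub, IH0, IH1, IH2, F0, F1, F2]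
      norm_num
      linear_combination (2 * c a * ∑ i ∈ S, c i) * h3
    · rw [iteratedDeriv_fun_mul (hf 3) (hg 3)]
      simp only [Finset.sum_range_succ, Finset.sum_range_zero, Nat.reduceSub, IH0, IH1, IH2, IH3, F0, F1,
        F2, F3]
      norm_num
      ring

/-! ## The registered sub-goals -/

section Family

variable {f : ℂ → ℝ} {R : ℝ}

/-- The power sums `Σᶠ_{u ∈ L} θ_u^m` (`m ≥ 1`) are finite sums over the loops meeting the ball
(`θ_u^m ≠ 0 ⇒ θ_u ≠ 0 ⇒ u` meets `B̄(0, R)`, `sw_meets_of_nestingPhase_ne_zero`). -/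
theorem cff_finsum_pow_eq_sum (hR : ∀ z, R < ‖z‖ → f z = 0) (h0 : ∫ z, f z = 0)
    {L : Set (UnbasedLoop ℂ)} (hfin : {u ∈ L | (u.range ∩ closedBall (0 : ℂ) R).Nonempty}.Finite)
    {m : ℕ} (hm : m ≠ 0) :
    ∑ᶠ u ∈ L, u.nestingPhase f ^ m = ∑ u ∈ hfin.toFinset, u.nestingPhase f ^ m :=
  finsum_mem_eq_sum_of_subset _
    (fun u hu ↦ hfin.mem_toFinset.2 ⟨hu.1, sw_meets_of_nestingPhase_ne_zero hR h0 fun h ↦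
      Function.mem_support.1 hu.2 (by rw [h]; exact zero_pow hm)⟩)
    (fun u hu ↦ (hfin.mem_toFinset.1 hu).1)

/-- The phase sum `Σᶠ_{u ∈ L} θ_u` is a finite sum over the loops meeting the ball. -/
theorem cff_finsum_eq_sum (hR : ∀ z, R < ‖z‖ → f z = 0) (h0 : ∫ z, f z = 0)
    {L : Set (UnbasedLoop ℂ)} (hfin : {u ∈ L | (u.range ∩ closedBall (0 : ℂ) R).Nonempty}.Finite) :
    ∑ᶠ u ∈ L, u.nestingPhase f = ∑ u ∈ hfin.toFinset, u.nestingPhase f := by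
  simpa only [pow_one] using cff_finsum_pow_eq_sum hR h0 hfin one_ne_zero

end Family

/-- **Sub-goal CF-b (`cf_iteratedDeriv_two_finprod`).**  The second `t`-derivative at zero coupling of
the pathwise twisted product `∏ᶠ_{u∈L} 2cos(t θ_u + π/3)` is `3A₁² − 4A₂`, `A_m = Σᶠ_{u∈L} θ_u^m`
(the `finprod` is a finite product over the loops meeting the ball; `cff_iteratedDeriv_prod`). -/
theorem cf_iteratedDeriv_two_finprod : ∀ (f : ℂ → ℝ) (R : ℝ), (∀ z, R < ‖z‖ → f z = 0) → ∫ z, f z = 0 →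
    ∀ L : Set (UnbasedLoop ℂ), {u ∈ L | (u.range ∩ Metric.closedBall (0 : ℂ) R).Nonempty}.Finite →
    iteratedDeriv 2 (fun t : ℂ ↦ ∏ᶠ u ∈ L, 2 * Complex.cos (t * ((u.nestingPhase f : ℝ) : ℂ) + (Real.pi : ℂ) / 3)) 0 =
      ((3 * (∑ᶠ u ∈ L, u.nestingPhase f) ^ 2 - 4 * (∑ᶠ u ∈ L, u.nestingPhase f ^ 2) : ℝ) : ℂ) := by
  intro f R hR h0 L hfin
  have hfun : (fun t : ℂ ↦ ∏ᶠ u ∈ L, 2 * Complex.cos (t * ((u.nestingPhase f : ℝ) : ℂ) + (Real.pi : ℂ) / 3)) =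
      fun t ↦ ∏ u ∈ hfin.toFinset, 2 * Complex.cos (t * ((u.nestingPhase f : ℝ) : ℂ) + (Real.pi : ℂ) / 3) :=
    funext (stubEntire_finprod_eq_prod hR h0 hfin)
  rw [hfun, (cff_iteratedDeriv_prod (fun u : UnbasedLoop ℂ ↦ ((u.nestingPhase f : ℝ) : ℂ)) hfin.toFinset).2.2.1,
    cff_finsum_eq_sum hR h0 hfin, cff_finsum_pow_eq_sum hR h0 hfin two_ne_zero]
  push_cast
  ring

/-- **Sub-goal CF-c (`cf_iteratedDeriv_three_finprod`).**  The third `t`-derivative at zero coupling of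
the pathwise twisted product `∏ᶠ_{u∈L} 2cos(t θ_u + π/3)` is `√3(−3A₁³ + 12A₁A₂ − 8A₃)`,
`A_m = Σᶠ_{u∈L} θ_u^m` (finite product over the loops meeting the ball; `cff_iteratedDeriv_prod`). -/
theorem cf_iteratedDeriv_three_finprod : ∀ (f : ℂ → ℝ) (R : ℝ), (∀ z, R < ‖z‖ → f z = 0) → ∫ z, f z = 0 →
    ∀ L : Set (UnbasedLoop ℂ), {u ∈ L | (u.range ∩ Metric.closedBall (0 : ℂ) R).Nonempty}.Finite →
    iteratedDeriv 3 (fun t : ℂ ↦ ∏ᶠ u ∈ L, 2 * Complex.cos (t * ((u.nestingPhase f : ℝ) : ℂ) + (Real.pi : ℂ) / 3)) 0 =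
      ((Real.sqrt 3 * (-3 * (∑ᶠ u ∈ L, u.nestingPhase f) ^ 3 +
        12 * (∑ᶠ u ∈ L, u.nestingPhase f) * (∑ᶠ u ∈ L, u.nestingPhase f ^ 2) -
        8 * (∑ᶠ u ∈ L, u.nestingPhase f ^ 3)) : ℝ) : ℂ) := by
  intro f R hR h0 L hfin
  have hfun : (fun t : ℂ ↦ ∏ᶠ u ∈ L, 2 * Complex.cos (t * ((u.nestingPhase f : ℝ) : ℂ) + (Real.pi : ℂ) / 3)) =
      fun t ↦ ∏ u ∈ hfin.toFinset, 2 * Complex.cos (t * ((u.nestingPhase f : ℝ) : ℂ) + (Real.pi : ℂ) / 3) :=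
    funext (stubEntire_finprod_eq_prod hR h0 hfin)
  rw [hfun, (cff_iteratedDeriv_prod (fun u : UnbasedLoop ℂ ↦ ((u.nestingPhase f : ℝ) : ℂ)) hfin.toFinset).2.2.2,
    cff_finsum_eq_sum hR h0 hfin, cff_finsum_pow_eq_sum hR h0 hfin two_ne_zero,
    cff_finsum_pow_eq_sum hR h0 hfin three_ne_zero]
  push_cast
  ring

end Summit.CriticalPhenomena.CardyFormulaZ2.Cruxes.MagicFormulaT.LineSketch

end
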